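import Literature.Geometry.Lorentzian.CauchyDevelopmentRestrict
import Literature.Geometry.Lorentzian.CauchyDevelopmentOneJet
import Literature.Geometry.Lorentzian.InitialDataPullback
import Literature.Geometry.Lorentzian.SecondFundamentalFormApply
import Literature.Topology.FourManifolds.ImmersionCriterion
import HarnessLib

/-!
# Re-basing a data embedding along an open embedding of the data manifold
# (Cauchy developments of sub-data; Choquet-Bruhat–Geroch 1969, p. 330; Sbierski 2016, Def. 2.2)

If `𝒮 = (M, g, τ, ι, ν)` is a data embedding of the initial data set `D = (h, k)` on `X`
(`DataEmbedding`, `CauchyDevelopment.lean`) and `Φ : N → X` is a smooth open embedding all of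
whose differentials are injective (`N` connected), then `(M, g, τ, ι ∘ Φ, ν ∘ Φ)` is a data
embedding of the **pulled-back data** `Φ^* D = D.comap Φ` on `N` (`InitialDataSet.comap`,
`InitialDataPullback.lean`): the induced metric of `ι ∘ Φ` is `Φ^*(ι^* g) = Φ^* h` and its second
fundamental form w.r.t. `ν ∘ Φ` is `Φ^* K_ν = Φ^* k`. This is the (trivial) sense in which a
development of `D` "develops" the data induced on any open subset of the data hypersurface
(Choquet-Bruhat–Geroch, Comm. Math. Phys. 14 (1969), p. 330: the data induced on `S`; Hawking–Ellis
1973, §7.5, "a development of part of `𝒮`"); restricted to an open subset of `M` in which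
`ι(Φ N)` is a Cauchy hypersurface — e.g. its domain of dependence — it becomes a Cauchy development
of `Φ^* D` (`DataEmbedding.restrict`/`CauchyDevelopment` constructor, `CauchyDevelopmentRestrict.lean`).

* `PseudoRiemannianMetric.normalDerivAlong_comp_right`, `secondFundamentalForm_comp_right` —
  **reparametrisation naturality of the shape tensor in its domain**: for a hypersurface map
  `f : X → M` with normal field `ν` and a map `Ψ : N → X`,
  `D_v (ν ∘ Ψ) = D_{dΨ v} ν` and `K_{f ∘ Ψ, ν ∘ Ψ}(v, w) = K_{f, ν}(dΨ v, dΨ w)` (the induced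
  covariant derivative depends on the curve only through its velocity: the frame formula
  `normalDerivAlong_eq` of `SecondFundamentalFormApply.lean`, O'Neill 1983, Ch. 4, Lemma 4.1 and
  Cor. 4.2 (1), plus the chain rule);
* `DataEmbedding.comapAlong 𝒮 Φ …` — the re-based data embedding of `D.comap Φ`, and
  `DataEmbedding.comapAlong_isVacuum` (same metric, so vacuum iff `𝒮` is).

Everything is proved; the only definition is the re-based data embedding; no named facts.

## References

* Y. Choquet-Bruhat, R. Geroch, Comm. Math. Phys. 14 (1969) 329–335, p. 330.
* J. Sbierski, Ann. Henri Poincaré 17 (2016) 301–329 = arXiv:1309.7591, Def. 2.2.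
* S. W. Hawking, G. F. R. Ellis, *The large scale structure of space-time*, CUP 1973, §7.5.
* B. O'Neill, *Semi-Riemannian geometry*, 1983, Ch. 4, Lemma 4.1, Cor. 4.2, Lemma 4.4.
* R. Bartnik, J. Isenberg, *The constraint equations* (2004), §2 (diffeomorphism covariance).
-/

noncomputable section

open Bundle Set Function Filter Topology TopologicalSpace Manifold
open scoped Manifold ContDiff Topology

namespace Literature.Geometry.Lorentzian

universe u v

/-! ### Reparametrisation naturality of `D_v ν` and of the second fundamental form -/

namespace PseudoRiemannianMetric

section Reparam

variable {E : Type*} [NormedAddCommGroup E] [NormedSpace ℝ E] {H : Type*} [TopologicalSpace H]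
  {I : ModelWithCorners ℝ E H} {M : Type*} [TopologicalSpace M] [ChartedSpace H M]
  [IsManifold I ∞ M] [FiniteDimensional ℝ E] {n : ℕ∞ω}
  (g : PseudoRiemannianMetric I n E (TangentSpace I : M → Type _)) [g.HasLeviCivita]
  {EX : Type*} [NormedAddCommGroup EX] [NormedSpace ℝ EX] {HX : Type*} [TopologicalSpace HX]
  {IX : ModelWithCorners ℝ EX HX} {X : Type*} [TopologicalSpace X] [ChartedSpace HX X]
  [IsManifold IX ∞ X]
  {EN : Type*} [NormedAddCommGroup EN] [NormedSpace ℝ EN] {HN : Type*} [TopologicalSpace HN]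
  {IN : ModelWithCorners ℝ EN HN} {N : Type*} [TopologicalSpace N] [ChartedSpace HN N]
  [IsManifold IN ∞ N]

/-- **`D_v (ν ∘ Ψ) = D_{dΨ v} ν`**: the covariant derivative, along the reparametrised
hypersurface map `f ∘ Ψ`, of the reparametrised field `ν ∘ Ψ` in the direction `v ∈ T_u N` is the
covariant derivative of `ν` along `f` in the direction `dΨ_u v` — the induced covariant derivative
depends on a curve only through its velocity (O'Neill 1983, Ch. 4, Lemma 4.1 and Cor. 4.2 (1):
`D̄_V X = ∑ V(fⁱ) ∂ᵢ + ∑ fⁱ D̄_V ∂ᵢ`), here via the frame formula `normalDerivAlong_eq` on both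
sides and the chain rules `d(sⁱ(ν) ∘ Ψ) = d(sⁱ(ν)) ∘ dΨ`, `d(f ∘ Ψ) = df ∘ dΨ`. Hypotheses: `u`
and `Ψ u` interior points, `ν` differentiable at `Ψ u` as a map `X → TM`, `Ψ` differentiable at
`u`. [cite: ONeill1983, Ch. 4, Lemma 4.1 and Cor. 4.2] -/
theorem normalDerivAlong_comp_right {f : X → M} {ν : NormalField I f} {Ψ : N → X} {u : N}
    (hu : IN.IsInteriorPoint u) (hΨu : IX.IsInteriorPoint (Ψ u))
    (hν : MDifferentiableAt IX I.tangent
      (fun x ↦ (TotalSpace.mk' E (f x) (ν x) : TangentBundle I M)) (Ψ u))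
    (hΨ : MDifferentiableAt IN IX Ψ u) (v : TangentSpace IN u) :
    g.normalDerivAlong (f ∘ Ψ) (fun u ↦ ν (Ψ u)) u v =
      g.normalDerivAlong f ν (Ψ u) (mfderiv IN IX Ψ u v) := by
  -- unfold the composition (so that all tangent spaces are at the point `f (Ψ u)`)
  show g.normalDerivAlong (fun x ↦ f (Ψ x)) (fun u ↦ ν (Ψ u)) u v = _
  -- the reparametrised field is differentiable at `u`
  have hν' : MDifferentiableAt IN I.tangent
      (fun x ↦ (TotalSpace.mk' E (f (Ψ x)) (ν (Ψ x)) : TangentBundle I M)) u :=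
    hν.comp u hΨ
  rw [g.normalDerivAlong_eq hu hν' v, g.normalDerivAlong_eq hΨu hν (mfderiv IN IX Ψ u v)]
  set e := trivializationAt E (TangentSpace I : M → Type _) (f (Ψ u)) with he_def
  set b := Module.finBasis ℝ E with hb_def
  -- differentiability of `f` and of the coefficient functions `sⁱ(ν)` at `Ψ u`
  have hf : MDifferentiableAt IX I f (Ψ u) := ((mdifferentiableAt_totalSpace I _).1 hν).1
  have hνc : MDifferentiableAt IX 𝓘(ℝ, E)
      (fun x ↦ (e (TotalSpace.mk' E (f x) (ν x) : TangentBundle I M)).2) (Ψ u) :=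
    ((mdifferentiableAt_totalSpace I _).1 hν).2
  have hfe : ∀ᶠ x in 𝓝 (Ψ u), f x ∈ e.baseSet :=
    hf.continuousAt.preimage_mem_nhds
      (e.open_baseSet.mem_nhds (FiberBundle.mem_baseSet_trivializationAt' (f (Ψ u))))
  have hφ : ∀ i, MDifferentiableAt IX 𝓘(ℝ, ℝ) (fun x ↦ e.localFrame_coeff I b i (f x) (ν x))
      (Ψ u) := by
    intro i
    have h1 : MDifferentiableAt IX 𝓘(ℝ, ℝ)
        (fun x ↦ b.coord i (e (TotalSpace.mk' E (f x) (ν x) : TangentBundle I M)).2) (Ψ u) :=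
      (LinearMap.toContinuousLinearMap (b.coord i)).mdifferentiableAt.comp (Ψ u) hνc
    refine h1.congr_of_eventuallyEq ?_
    filter_upwards [hfe] with x hx
    rw [e.localFrame_coeff_eq_coeff (b := b) (s := fun _ ↦ ν x) hx]
    simp
  -- chain rules
  have hcoeff : ∀ i, mfderiv IN 𝓘(ℝ, ℝ) (fun x ↦ e.localFrame_coeff I b i (f (Ψ x)) (ν (Ψ x))) u v
      = mfderiv IX 𝓘(ℝ, ℝ) (fun x ↦ e.localFrame_coeff I b i (f x) (ν x)) (Ψ u)
          (mfderiv IN IX Ψ u v) := fun i ↦ by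
    have h := mfderiv_comp u (hφ i) hΨ
    exact congrArg (fun L ↦ L v) h
  have hfΨ : mfderiv IN I (fun x ↦ f (Ψ x)) u v = mfderiv IX I f (Ψ u) (mfderiv IN IX Ψ u v) := by
    have h := mfderiv_comp u hf hΨ
    exact congrArg (fun L ↦ L v) h
  rw [hfΨ]
  congr 1
  refine Finset.sum_congr rfl fun i _ ↦ ?_
  rw [hcoeff i]

variable [FiniteDimensional ℝ EX] [FiniteDimensional ℝ EN]

/-- **Reparametrisation naturality of the second fundamental form in its domain**:
`K_{f ∘ Ψ, ν ∘ Ψ}(v, w) = K_{f, ν}(dΨ_u v, dΨ_u w)` for `v, w ∈ T_u N` (both sides are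
`g(D ν, d(·) w)`, `secondFundamentalForm_apply_holds`; then `normalDerivAlong_comp_right` and the
chain rule). With `Ψ` a local diffeomorphism this says that the extrinsic curvature of a
hypersurface does not depend on its parametrisation (O'Neill 1983, Ch. 4, Lemma 4.4: the shape
tensor is a tensor on the submanifold); it is the `k`-half of the diffeomorphism covariance of
initial data (Bartnik–Isenberg 2004, §2). [cite: ONeill1983, Ch. 4, Lemma 4.4] -/
theorem secondFundamentalForm_comp_right {f : X → M} {ν : NormalField I f} {Ψ : N → X} {u : N}
    (hu : IN.IsInteriorPoint u) (hΨu : IX.IsInteriorPoint (Ψ u))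
    (hν : MDifferentiableAt IX I.tangent
      (fun x ↦ (TotalSpace.mk' E (f x) (ν x) : TangentBundle I M)) (Ψ u))
    (hΨ : MDifferentiableAt IN IX Ψ u) (v w : TangentSpace IN u) :
    g.secondFundamentalForm IN (f ∘ Ψ) (fun u ↦ ν (Ψ u)) u v w =
      g.secondFundamentalForm IX f ν (Ψ u) (mfderiv IN IX Ψ u v) (mfderiv IN IX Ψ u w) := by
  show g.secondFundamentalForm IN (fun x ↦ f (Ψ x)) (fun u ↦ ν (Ψ u)) u v w = _
  have hν' : MDifferentiableAt IN I.tangent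
      (fun x ↦ (TotalSpace.mk' E (f (Ψ x)) (ν (Ψ x)) : TangentBundle I M)) u :=
    hν.comp u hΨ
  have hf : MDifferentiableAt IX I f (Ψ u) := ((mdifferentiableAt_totalSpace I _).1 hν).1
  have hfΨ : mfderiv IN I (fun x ↦ f (Ψ x)) u w = mfderiv IX I f (Ψ u) (mfderiv IN IX Ψ u w) := by
    have h := mfderiv_comp u hf hΨ
    exact congrArg (fun L ↦ L w) h
  have hD := g.normalDerivAlong_comp_right hu hΨu hν hΨ v
  rw [secondFundamentalForm_apply_holds hu hν' v w,
    secondFundamentalForm_apply_holds hΨu hν _ _, hfΨ]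
  exact congrArg (fun z ↦ g.val (f (Ψ u)) z (mfderiv IX I f (Ψ u) (mfderiv IN IX Ψ u w))) hD

end Reparam

end PseudoRiemannianMetric

/-! ### The re-based data embedding of pulled-back data -/

section Developments

variable {n : ℕ}
  {X : Type u} [TopologicalSpace X] [ChartedSpace (EuclideanSpace ℝ (Fin n)) X]
  [IsManifold (𝓡 n) ∞ X] [ConnectedSpace X] {D : InitialDataSet (𝓡 n) X}
  {N : Type u} [TopologicalSpace N] [ChartedSpace (EuclideanSpace ℝ (Fin n)) N]
  [IsManifold (𝓡 n) ∞ N] [ConnectedSpace N]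

namespace DataEmbedding

variable (𝒮 : DataEmbedding D)

/-- **Re-basing a data embedding along an open embedding of the data manifold.** For a data
embedding `𝒮 = (M, g, τ, ι, ν)` of `D` on `X` and a smooth open embedding `Φ : N → X` with
injective differentials (and the normal `ν` of `𝒮` differentiable along `ι` at the points of
`Φ(N)`, true for genuine developments — the same displayed hypothesis as in
`DataEmbedding.restrict`), the data embedding `(M, g, τ, ι ∘ Φ, ν ∘ Φ)` of the pulled-back data
`D.comap Φ` on `N`: `ι ∘ Φ` is a smooth embedding (an injective-differential immersion,
`isImmersion_of_injective_mfderiv`, and a composite of topological embeddings), `ν ∘ Φ` is its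
future unit normal (`dΦ` is onto, `N` and `X` being equidimensional), the induced metric is
`Φ^*(ι^* g) = Φ^* h` (`pullbackBilin_comp`) and the second fundamental form is
`Φ^* K_ν = Φ^* k` (`secondFundamentalForm_comp_right`). Choquet-Bruhat–Geroch 1969, p. 330 (the
data induced on a hypersurface); Sbierski 2016, Def. 2.2; Bartnik–Isenberg 2004, §2.
[cite: ChoquetBruhatGeroch1969CMP, p. 330] -/
def comapAlong (Φ : N → X) (hΦ : ContMDiff (𝓡 n) (𝓡 n) (∞ + 1) Φ)
    (hΦ' : ∀ u, Injective (mfderiv (𝓡 n) (𝓡 n) Φ u)) (hΦo : IsOpenEmbedding Φ)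
    (hν : ∀ u, MDifferentiableAt (𝓡 n) (𝓡 (n + 1)).tangent
      (fun x ↦ (TotalSpace.mk' (EuclideanSpace ℝ (Fin (n + 1))) (𝒮.embed x) (𝒮.normal x) :
        TangentBundle (𝓡 (n + 1)) 𝒮.carrier)) (Φ u)) :
    DataEmbedding (D.comap Φ hΦ hΦ') where
  toSpacetime := 𝒮.toSpacetime
  embed := 𝒮.embed ∘ Φ
  isSmoothEmbedding := by
    have hΦs : ContMDiff (𝓡 n) (𝓡 n) ∞ Φ := hΦ.of_le le_self_add
    have hc : ContMDiff (𝓡 n) (𝓡 (n + 1)) ∞ (𝒮.embed ∘ Φ) := 𝒮.isSmoothEmbedding.contMDiff.comp hΦs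
    refine ⟨Literature.Topology.FourManifolds.isImmersion_of_injective_mfderiv hc (by simp)
      fun u ↦ ?_, 𝒮.isSmoothEmbedding.isEmbedding.comp hΦo.isEmbedding⟩
    rw [mfderiv_comp u (𝒮.mdifferentiable_embed (Φ u)) (hΦs.mdifferentiableAt (by simp) )]
    exact (𝒮.mfderiv_embed_injective (Φ u)).comp (hΦ' u)
  normal := fun u ↦ 𝒮.normal (Φ u)
  isFutureUnitNormal := by
    have hΦs : ContMDiff (𝓡 n) (𝓡 n) ∞ Φ := hΦ.of_le le_self_add
    refine ⟨⟨fun u v ↦ ?_, fun u ↦ 𝒮.isFutureUnitNormal.1.2 (Φ u)⟩,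
      fun u ↦ 𝒮.isFutureUnitNormal.2 (Φ u)⟩
    change 𝒮.metric.val (𝒮.embed (Φ u)) (𝒮.normal (Φ u))
      (mfderiv (𝓡 n) (𝓡 (n + 1)) (𝒮.embed ∘ Φ) u v) = 0
    rw [mfderiv_comp u (𝒮.mdifferentiable_embed (Φ u)) (hΦs.mdifferentiableAt (by simp))]
    exact 𝒮.isFutureUnitNormal.1.1 (Φ u) (mfderiv (𝓡 n) (𝓡 n) Φ u v)
  induced_h := fun u ↦ by
    have hΦs : ContMDiff (𝓡 n) (𝓡 n) ∞ Φ := hΦ.of_le le_self_add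
    ext v w
    rw [pullbackBilin_comp 𝒮.mdifferentiable_embed (hΦs.mdifferentiable (by simp)),
      show pullbackBilin (I := 𝓡 (n + 1)) (I' := 𝓡 n) 𝒮.embed 𝒮.metric.val = D.h.inner from
        funext 𝒮.induced_h, pullbackBilin_apply, InitialDataSet.comap_h_inner]
  induced_k := by
    intro inst u
    have hΦs : ContMDiff (𝓡 n) (𝓡 n) ∞ Φ := hΦ.of_le le_self_add
    refine LinearMap.ext fun v ↦ LinearMap.ext fun w ↦ ?_
    rw [InitialDataSet.kBilin_apply, InitialDataSet.comap_k, ← InitialDataSet.kBilin_apply,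
      ← 𝒮.induced_k (Φ u)]
    exact 𝒮.metric.toPseudoRiemannianMetric.secondFundamentalForm_comp_right
      (f := 𝒮.embed) (ν := 𝒮.normal) (Ψ := Φ) BoundarylessManifold.isInteriorPoint
      BoundarylessManifold.isInteriorPoint (hν u) (hΦs.mdifferentiableAt (by simp)) v w

/-- The re-based data embedding has the same spacetime; in particular it is vacuum iff the
original one is. Ringström 2009, Def. 16.3. [cite: Ringstrom2009, Def. 16.3] -/
theorem comapAlong_isVacuum {Φ : N → X} {hΦ : ContMDiff (𝓡 n) (𝓡 n) (∞ + 1) Φ}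
    {hΦ' : ∀ u, Injective (mfderiv (𝓡 n) (𝓡 n) Φ u)} {hΦo : IsOpenEmbedding Φ}
    {hν : ∀ u, MDifferentiableAt (𝓡 n) (𝓡 (n + 1)).tangent
      (fun x ↦ (TotalSpace.mk' (EuclideanSpace ℝ (Fin (n + 1))) (𝒮.embed x) (𝒮.normal x) :
        TangentBundle (𝓡 (n + 1)) 𝒮.carrier)) (Φ u)}
    (h : 𝒮.IsVacuum) : (𝒮.comapAlong Φ hΦ hΦ' hΦo hν).IsVacuum := by
  intro inst
  haveI : 𝒮.metric.toPseudoRiemannianMetric.HasLeviCivita := inst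
  exact h

/-- The fields of the re-based data embedding: same spacetime, embedding `ι ∘ Φ`, normal
`ν ∘ Φ`. [folklore] -/
theorem comapAlong_toSpacetime {Φ : N → X} {hΦ : ContMDiff (𝓡 n) (𝓡 n) (∞ + 1) Φ}
    {hΦ' : ∀ u, Injective (mfderiv (𝓡 n) (𝓡 n) Φ u)} {hΦo : IsOpenEmbedding Φ}
    {hν : ∀ u, MDifferentiableAt (𝓡 n) (𝓡 (n + 1)).tangent
      (fun x ↦ (TotalSpace.mk' (EuclideanSpace ℝ (Fin (n + 1))) (𝒮.embed x) (𝒮.normal x) :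
        TangentBundle (𝓡 (n + 1)) 𝒮.carrier)) (Φ u)} :
    (𝒮.comapAlong Φ hΦ hΦ' hΦo hν).toSpacetime = 𝒮.toSpacetime ∧
      (𝒮.comapAlong Φ hΦ hΦ' hΦo hν).embed = 𝒮.embed ∘ Φ ∧
      (𝒮.comapAlong Φ hΦ hΦ' hΦo hν).normal = fun u ↦ 𝒮.normal (Φ u) :=
  ⟨rfl, rfl, rfl⟩

/-- The normal of the re-based data embedding is differentiable along its embedding `ι ∘ Φ`
(chain rule), i.e. the re-based embedding again satisfies the displayed hypothesis of
`DataEmbedding.restrict` / `comapAlong`. [folklore] -/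
theorem mdifferentiableAt_normal_comapAlong {Φ : N → X} (hΦ : ContMDiff (𝓡 n) (𝓡 n) (∞ + 1) Φ)
    (hΦ' : ∀ u, Injective (mfderiv (𝓡 n) (𝓡 n) Φ u)) (hΦo : IsOpenEmbedding Φ)
    (hν : ∀ u, MDifferentiableAt (𝓡 n) (𝓡 (n + 1)).tangent
      (fun x ↦ (TotalSpace.mk' (EuclideanSpace ℝ (Fin (n + 1))) (𝒮.embed x) (𝒮.normal x) :
        TangentBundle (𝓡 (n + 1)) 𝒮.carrier)) (Φ u)) (u : N) :
    MDifferentiableAt (𝓡 n) (𝓡 (n + 1)).tangent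
      (fun x ↦ (TotalSpace.mk' (EuclideanSpace ℝ (Fin (n + 1)))
        ((𝒮.comapAlong Φ hΦ hΦ' hΦo hν).embed x) ((𝒮.comapAlong Φ hΦ hΦ' hΦo hν).normal x) :
        TangentBundle (𝓡 (n + 1)) 𝒮.carrier)) u :=
  (hν u).comp u ((hΦ.of_le le_self_add).mdifferentiableAt (by simp))

end DataEmbedding

namespace CauchyDevelopment

variable (𝒟 : CauchyDevelopment D)

/-- **A Cauchy development of the data develops the sub-data on every open region in which the
sub-datum is still a Cauchy hypersurface.** For a Cauchy development `𝒟 = (M, g, τ, ι, ν)` of `D`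
on `X`, a smooth open embedding `Φ : N → X` with injective differentials, and an open connected
`V ⊆ M` containing `ι(Φ N)` in which `ι(Φ N)` is a Cauchy hypersurface (e.g. its domain of
dependence), the Cauchy development `(V, g|_V, τ|_V, ι ∘ Φ, ν ∘ Φ)` of the pulled-back data
`D.comap Φ` (`DataEmbedding.comapAlong` then `DataEmbedding.restrict`). Choquet-Bruhat–Geroch 1969,
p. 330 and p. 332 ("an open subset U of N … such that U is a development"); Sbierski 2016,
Def. 2.2 and 2.4; Hawking–Ellis 1973, §7.5 ("a development of part of `𝒮`").
[cite: Sbierski2016AHP, Def. 2.2 and Def. 2.4] -/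
def comapAlongRestrict (Φ : N → X) (hΦ : ContMDiff (𝓡 n) (𝓡 n) (∞ + 1) Φ)
    (hΦ' : ∀ u, Injective (mfderiv (𝓡 n) (𝓡 n) Φ u)) (hΦo : IsOpenEmbedding Φ)
    (hν : ∀ u, MDifferentiableAt (𝓡 n) (𝓡 (n + 1)).tangent
      (fun x ↦ (TotalSpace.mk' (EuclideanSpace ℝ (Fin (n + 1))) (𝒟.embed x) (𝒟.normal x) :
        TangentBundle (𝓡 (n + 1)) 𝒟.carrier)) (Φ u))
    (V : Opens 𝒟.carrier) (hV : IsConnected (V : Set 𝒟.carrier)) (hι : ∀ u, 𝒟.embed (Φ u) ∈ V)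
    (hC : (𝒟.metric.restrict PseudoRiemannianMetric.contMDiff_restrict_holds V).IsCauchyHypersurface
      (𝒟.timeOrientation.restrict PseudoRiemannianMetric.contMDiff_restrict_holds
        𝒟.timeOrientation.contMDiff_restrict_holds V)
      (range ((𝒟.toDataEmbedding.comapAlong Φ hΦ hΦ' hΦo hν).embedOpens V hι))) :
    CauchyDevelopment (D.comap Φ hΦ hΦ') where
  toDataEmbedding := (𝒟.toDataEmbedding.comapAlong Φ hΦ hΦ' hΦo hν).restrict V hV hι
    (𝒟.toDataEmbedding.mdifferentiableAt_normal_comapAlong hΦ hΦ' hΦo hν)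
  isCauchyHypersurface := hC

/-- **The sub-data development embeds into the development over `Φ`**: the inclusion `V ⊆ M` is a
smooth, time-orientation preserving, isometric open embedding `χ` with `χ ∘ (ι ∘ Φ) = ι ∘ Φ`
(`DataEmbedding.restrict_embedsInto` for the re-based data embedding) — a witness of exactly the
shape asked for by statements that sub-data developments embed. Sbierski 2016, Def. 2.4.
[cite: Sbierski2016AHP, Def. 2.4] -/
theorem comapAlongRestrict_embeds (Φ : N → X) (hΦ : ContMDiff (𝓡 n) (𝓡 n) (∞ + 1) Φ)
    (hΦ' : ∀ u, Injective (mfderiv (𝓡 n) (𝓡 n) Φ u)) (hΦo : IsOpenEmbedding Φ)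
    (hν : ∀ u, MDifferentiableAt (𝓡 n) (𝓡 (n + 1)).tangent
      (fun x ↦ (TotalSpace.mk' (EuclideanSpace ℝ (Fin (n + 1))) (𝒟.embed x) (𝒟.normal x) :
        TangentBundle (𝓡 (n + 1)) 𝒟.carrier)) (Φ u))
    (V : Opens 𝒟.carrier) (hV : IsConnected (V : Set 𝒟.carrier)) (hι : ∀ u, 𝒟.embed (Φ u) ∈ V)
    (hC : (𝒟.metric.restrict PseudoRiemannianMetric.contMDiff_restrict_holds V).IsCauchyHypersurface
      (𝒟.timeOrientation.restrict PseudoRiemannianMetric.contMDiff_restrict_holds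
        𝒟.timeOrientation.contMDiff_restrict_holds V)
      (range ((𝒟.toDataEmbedding.comapAlong Φ hΦ hΦ' hΦo hν).embedOpens V hι))) :
    ∃ χ : (𝒟.comapAlongRestrict Φ hΦ hΦ' hΦo hν V hV hι hC).carrier → 𝒟.carrier,
      ContMDiff (𝓡 (n + 1)) (𝓡 (n + 1)) ∞ χ ∧ IsOpenEmbedding χ ∧
        (𝒟.comapAlongRestrict Φ hΦ hΦ' hΦo hν V hV hι hC).metric.IsIsometricImmersion
          𝒟.metric.toPseudoRiemannianMetric χ ∧
        (𝒟.comapAlongRestrict Φ hΦ hΦ' hΦo hν V hV hι hC).timeOrientation.PreservesTimeOrientation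
          χ 𝒟.timeOrientation ∧
        χ ∘ (𝒟.comapAlongRestrict Φ hΦ hΦ' hΦo hν V hV hι hC).embed = 𝒟.embed ∘ Φ :=
  (𝒟.toDataEmbedding.comapAlong Φ hΦ hΦ' hΦo hν).restrict_embedsInto V hV hι
    (𝒟.toDataEmbedding.mdifferentiableAt_normal_comapAlong hΦ hΦ' hΦo hν)

end CauchyDevelopment

namespace VacuumCauchyDevelopment

/-- **The vacuum case**: for a vacuum Cauchy development the sub-data development of
`CauchyDevelopment.comapAlongRestrict` is vacuum (`Ric(g|_V) = 0`,
`DataEmbedding.isRicciFlat_restrict`). Sbierski 2016, Def. 2.2 and 2.4.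
[cite: Sbierski2016AHP, Def. 2.2 and Def. 2.4] -/
def comapAlongRestrict (𝒟 : VacuumCauchyDevelopment D) (Φ : N → X)
    (hΦ : ContMDiff (𝓡 n) (𝓡 n) (∞ + 1) Φ) (hΦ' : ∀ u, Injective (mfderiv (𝓡 n) (𝓡 n) Φ u))
    (hΦo : IsOpenEmbedding Φ)
    (hν : ∀ u, MDifferentiableAt (𝓡 n) (𝓡 (n + 1)).tangent
      (fun x ↦ (TotalSpace.mk' (EuclideanSpace ℝ (Fin (n + 1))) (𝒟.embed x) (𝒟.normal x) :
        TangentBundle (𝓡 (n + 1)) 𝒟.carrier)) (Φ u))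
    (V : Opens 𝒟.carrier) (hV : IsConnected (V : Set 𝒟.carrier)) (hι : ∀ u, 𝒟.embed (Φ u) ∈ V)
    (hC : (𝒟.metric.restrict PseudoRiemannianMetric.contMDiff_restrict_holds V).IsCauchyHypersurface
      (𝒟.timeOrientation.restrict PseudoRiemannianMetric.contMDiff_restrict_holds
        𝒟.timeOrientation.contMDiff_restrict_holds V)
      (range ((𝒟.toDataEmbedding.comapAlong Φ hΦ hΦ' hΦo hν).embedOpens V hι))) :
    VacuumCauchyDevelopment (D.comap Φ hΦ hΦ') where
  toCauchyDevelopment := 𝒟.toCauchyDevelopment.comapAlongRestrict Φ hΦ hΦ' hΦo hν V hV hι hC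
  isRicciFlat := by
    intro inst
    haveI : ((𝒟.toDataEmbedding.comapAlong Φ hΦ hΦ' hΦo hν).metric.restrict
        PseudoRiemannianMetric.contMDiff_restrict_holds V).toPseudoRiemannianMetric.HasLeviCivita :=
      inst
    exact (𝒟.toDataEmbedding.comapAlong Φ hΦ hΦ' hΦo hν).isRicciFlat_restrict V
      ((𝒟.toDataEmbedding).comapAlong_isVacuum 𝒟.isVacuum)

end VacuumCauchyDevelopment

end Developments

end Literature.Geometry.Lorentzian

end
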